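import Summits.HodgeConjecture.HodgeConjecture.Theorems.MarkmanPartnerTransportPicardThreeK3SquaresRMTypeDescent
import Literature.AlgebraicGeometry.Surfaces.K3TranscendentalLatticeSignatureHolds
import Literature.LinearAlgebra.QuadraticForm.CartanDieudonne
import HarnessLib

/-!
# Route MarkmanPartnerTransport · crux `PicardThreeK3Squares` (stmt-HodgeConjecture-19652) —
# «RATIONAL ORBIT DENSITY» 1/4: the rational symmetries `R_v ∈ G_θ(ℚ)` through the `θ`-cyclic subspaces

Cell hodge-nonav, crux #4 of route MarkmanPartnerTransport (HC⁴(S ⊗ S) for projective K3 surfaces with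
ρ(S) ≥ 3; open core: real multiplication). Programme «RATIONAL ORBIT DENSITY» (prover seat
hodge-nonav-19652-p1, gen 10; `--supports stmt-HodgeConjecture-19652`, helper): the cell's moduli
programme displays, per rational real-multiplication type `θ ∈ M₂₂(ℚ)` (`…RMTypeDefs`), the input
`RMTypeDominated θ` — an `RMSpreadFamily` at EVERY `θ`-eigen period, whose intended discharge needs the
universal family over the RM component plus Deligne's invariant-cycle theorem («moduli carriers do not
exist»). The programme replaces it by the WEAKER input «`θ` is cycle-induced at the marked K3 surfaces
whose periods lie in some non-empty OPEN subset of the Hodge locus `D_{θ,e}`», through the elementary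
fact proved in this series: **the rational centraliser `G_θ(ℚ) = {g ∈ O(Λ_ℚ) : gθ = θg}` has dense
orbits on `D_{θ,e} = {y ∈ Λ_ℂ : θ_ℂ y = e y, (y.y) = 0, (ȳ.y) > 0}`**, while HC⁴ ∕ cycle-inducedness of
`θ` is `G_θ(ℚ)`-invariant by Buskin transport (the pattern of `RMTypeDescent`, p620943).

THIS FILE (pure linear algebra, fact-free): §1 the orthogonal symmetry through a subspace `Z` on which a
reflexive form is non-degenerate (`subspaceSymm`: `−1` on `Z`, `+1` on `Z^⊥`; isometry; commutes with
every endomorphism preserving `Z` and `Z^⊥`); §2 cyclic subspaces `K[f]·v` (`cyclicSpan`; stability,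
polynomial representation, polynomials in a self-adjoint `f` are self-adjoint, action on eigenvectors);
§3 for the K3 lattice: the RATIONAL SYMMETRY `R_v` through `Z_v = ℚ[θ]·v ⊂ Λ_ℚ` (`ratSymm`, for
`k3FormRat`) and its complexification `R_v ⊗ ℂ = thetaC (matrix of R_v)` (`ratSymmC`): an isometry of
`(Λ_ℂ, k3Form)` defined over `ℚ`, commuting with `θ_ℂ`, equal to `−1` on the image of `Z_v` and to `+1`
on the COMPLEXIFIED orthogonal `(Z_v ⊗ ℂ)^⊥` (base change of `Λ_ℚ = Z_v ⊕ Z_v^⊥`,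
`eq_span_ratCast_of_forall_mem_iff`). No definition of mathematical content beyond these auxiliary
carriers (`subspaceSymm`, `cyclicSpan`, `cycQ`, `orthC`, `ratSymm`, `ratSymmC`); no sorry; nothing here
says HC is proved.

References: O'Meara, *Introduction to Quadratic Forms* (1963), §42–§43B (symmetries); Iversen,
*Hyperbolic Geometry* (1992), Ch. I §2 Prop. 2.3; Huybrechts, *Lectures on K3 Surfaces* (2016), Ch. 3
Lemma 3.1, Ch. 6 Prop. 1.5 and Rem. 3.3; Lang, *Algebra* (2002), Ch. XIV §2–§3, XV §6–§7, XVI §4; van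
Geemen–Schütt, Forum Math. Sigma 13 (2025) e2, §2.1, §3.4; Buskin, J. reine angew. Math. 755 (2019), §6.2.
-/

set_option linter.dupNamespace false

noncomputable section

namespace Summit.HodgeConjecture.HodgeConjecture.Theorems.MarkmanPartnerTransport.RMTypeOrbit

open Polynomial
open Literature.AlgebraicGeometry.Surfaces Literature.LinearAlgebra.QuadraticForm
open Summit.HodgeConjecture.HodgeConjecture.Theorems.MarkmanPartnerTransport.RMTypeDescent

/-! ### §1 The orthogonal symmetry through a non-degenerate subspace -/

section Generic

variable {K : Type*} [Field K] {V : Type*} [AddCommGroup V] [Module K V]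
  (B : LinearMap.BilinForm K V) (Z : Submodule K V)

/-- The **orthogonal symmetry through the subspace `Z`** (for a reflexive form `B` non-degenerate on
`Z`, so that `V = Z ⊕ Z^⊥`): `−1` on `Z`, `+1` on `Z^⊥`, i.e. `x ↦ x − 2·pr_Z(x)`.
[cite: Omeara1963, §42 (symmetries) and §43B] -/
def subspaceSymm [FiniteDimensional K V] (hB : B.IsRefl) (hZ : (B.restrict Z).Nondegenerate) : Module.End K V :=
  LinearMap.id - (2 : K) • (Z.subtype ∘ₗ Z.projectionOnto (B.orthogonal Z)
    (LinearMap.BilinForm.isCompl_orthogonal_of_restrict_nondegenerate hB hZ))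

variable {B Z}

/-- Decomposition along `V = Z ⊕ Z^⊥`, with the projection. [cite: Omeara1963, §42] -/
theorem exists_decomp [FiniteDimensional K V] (hB : B.IsRefl) (hZ : (B.restrict Z).Nondegenerate) (x : V) :
    ∃ z ∈ Z, ∃ u ∈ B.orthogonal Z, x = z + u ∧
      ((Z.projectionOnto (B.orthogonal Z)
        (LinearMap.BilinForm.isCompl_orthogonal_of_restrict_nondegenerate hB hZ) x : Z) : V) = z := by
  have hc := LinearMap.BilinForm.isCompl_orthogonal_of_restrict_nondegenerate hB hZ
  have hx : x ∈ Z ⊔ B.orthogonal Z := by rw [hc.sup_eq_top]; exact Submodule.mem_top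
  obtain ⟨z, hz, u, hu, rfl⟩ := Submodule.mem_sup.1 hx
  refine ⟨z, hz, u, hu, rfl, ?_⟩
  have h1 : (Z.projectionOnto (B.orthogonal Z) hc) z = ⟨z, hz⟩ :=
    Submodule.projectionOnto_apply_left hc ⟨z, hz⟩
  have h2 : (Z.projectionOnto (B.orthogonal Z) hc) u = 0 :=
    Submodule.projectionOnto_apply_right hc ⟨u, hu⟩
  rw [map_add, h1, h2, add_zero]

/-- The defining formula `s(x) = x − 2·pr_Z(x)`. [cite: Omeara1963, §42] -/
theorem subspaceSymm_apply [FiniteDimensional K V] (hB : B.IsRefl) (hZ : (B.restrict Z).Nondegenerate) (x : V) :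
    subspaceSymm B Z hB hZ x = x - (2 : K) • ((Z.projectionOnto (B.orthogonal Z)
      (LinearMap.BilinForm.isCompl_orthogonal_of_restrict_nondegenerate hB hZ) x : Z) : V) := rfl

/-- `s(z + u) = −z + u` for `z ∈ Z`, `u ∈ Z^⊥`. [cite: Omeara1963, §42] -/
theorem subspaceSymm_apply_of_decomp [FiniteDimensional K V] (hB : B.IsRefl) (hZ : (B.restrict Z).Nondegenerate)
    {z u : V} (hz : z ∈ Z) (hu : u ∈ B.orthogonal Z) :
    subspaceSymm B Z hB hZ (z + u) = -z + u := by
  have hc := LinearMap.BilinForm.isCompl_orthogonal_of_restrict_nondegenerate hB hZ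
  have h1 : (Z.projectionOnto (B.orthogonal Z) hc) z = ⟨z, hz⟩ :=
    Submodule.projectionOnto_apply_left hc ⟨z, hz⟩
  have h2 : (Z.projectionOnto (B.orthogonal Z) hc) u = 0 :=
    Submodule.projectionOnto_apply_right hc ⟨u, hu⟩
  rw [subspaceSymm_apply, map_add, h1, h2, add_zero, two_smul]
  change z + u - (z + z) = -z + u
  abel

/-- `s = −1` on `Z`. [cite: Omeara1963, §42] -/
theorem subspaceSymm_apply_of_mem [FiniteDimensional K V] (hB : B.IsRefl) (hZ : (B.restrict Z).Nondegenerate)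
    {z : V} (hz : z ∈ Z) : subspaceSymm B Z hB hZ z = -z := by
  have h := subspaceSymm_apply_of_decomp hB hZ hz (Submodule.zero_mem _)
  rwa [add_zero, add_zero] at h

/-- `s = +1` on `Z^⊥`. [cite: Omeara1963, §42] -/
theorem subspaceSymm_apply_of_mem_orthogonal [FiniteDimensional K V] (hB : B.IsRefl) (hZ : (B.restrict Z).Nondegenerate)
    {u : V} (hu : u ∈ B.orthogonal Z) : subspaceSymm B Z hB hZ u = u := by
  have h := subspaceSymm_apply_of_decomp hB hZ (Submodule.zero_mem _) hu
  rwa [zero_add, neg_zero, zero_add] at h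

/-- `s` is an isometry of `B`. [cite: Omeara1963, §42] -/
theorem isOrthogonal_subspaceSymm [FiniteDimensional K V] (hB : B.IsRefl) (hZ : (B.restrict Z).Nondegenerate) (x y : V) :
    B (subspaceSymm B Z hB hZ x) (subspaceSymm B Z hB hZ y) = B x y := by
  obtain ⟨z, hz, u, hu, rfl, -⟩ := exists_decomp hB hZ x
  obtain ⟨z', hz', u', hu', rfl, -⟩ := exists_decomp hB hZ y
  rw [subspaceSymm_apply_of_decomp hB hZ hz hu, subspaceSymm_apply_of_decomp hB hZ hz' hu']
  have h1 : B z u' = 0 := (LinearMap.BilinForm.mem_orthogonal_iff.1 hu') z hz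
  have h2 : B u z' = 0 := hB _ _ ((LinearMap.BilinForm.mem_orthogonal_iff.1 hu) z' hz')
  simp only [map_add, map_neg, LinearMap.add_apply, LinearMap.neg_apply, h1, h2]
  abel

/-- A `B`-self-adjoint endomorphism preserving `Z` preserves `Z^⊥`. [cite: Omeara1963, §42] -/
theorem map_mem_orthogonal_of_selfAdjoint {f : Module.End K V} (hf : ∀ a b, B (f a) b = B a (f b))
    (hfZ : ∀ z ∈ Z, f z ∈ Z) {u : V} (hu : u ∈ B.orthogonal Z) : f u ∈ B.orthogonal Z := by
  rw [LinearMap.BilinForm.mem_orthogonal_iff] at hu ⊢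
  intro n hn
  change B n (f u) = 0
  rw [← hf]
  exact hu (f n) (hfZ n hn)

/-- `s` commutes with every endomorphism preserving `Z` and `Z^⊥`. [cite: Omeara1963, §42] -/
theorem subspaceSymm_comp_eq [FiniteDimensional K V] (hB : B.IsRefl) (hZ : (B.restrict Z).Nondegenerate) {f : Module.End K V}
    (hfZ : ∀ z ∈ Z, f z ∈ Z) (hfO : ∀ u ∈ B.orthogonal Z, f u ∈ B.orthogonal Z) :
    subspaceSymm B Z hB hZ ∘ₗ f = f ∘ₗ subspaceSymm B Z hB hZ := by
  ext x
  obtain ⟨z, hz, u, hu, rfl, -⟩ := exists_decomp hB hZ x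
  rw [LinearMap.comp_apply, LinearMap.comp_apply, map_add,
    subspaceSymm_apply_of_decomp hB hZ (hfZ z hz) (hfO u hu),
    subspaceSymm_apply_of_decomp hB hZ hz hu, map_add, map_neg]

end Generic

/-! ### §2 Cyclic subspaces of an endomorphism -/

section Cyclic

variable {K : Type*} [Field K] {V : Type*} [AddCommGroup V] [Module K V]

/-- The cyclic subspace `K[f]·v` spanned by the iterates `f^k v`. [cite: Lang2002, Ch. XIV §2 (cyclic modules over K[X])] -/
def cyclicSpan (f : Module.End K V) (v : V) : Submodule K V :=
  Submodule.span K (Set.range fun k : ℕ => (f ^ k) v)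

/-- The iterates `f^k v` lie in `K[f]·v`. [cite: Lang2002, Ch. XIV §2] -/
theorem pow_apply_mem_cyclicSpan (f : Module.End K V) (v : V) (k : ℕ) : (f ^ k) v ∈ cyclicSpan f v :=
  Submodule.subset_span ⟨k, rfl⟩

/-- `v ∈ K[f]·v`. [cite: Lang2002, Ch. XIV §2] -/
theorem self_mem_cyclicSpan (f : Module.End K V) (v : V) : v ∈ cyclicSpan f v := by
  simpa using pow_apply_mem_cyclicSpan f v 0

/-- `K[f]·v` is `f`-stable. [cite: Lang2002, Ch. XIV §2] -/
theorem map_mem_cyclicSpan (f : Module.End K V) (v : V) {z : V} (hz : z ∈ cyclicSpan f v) :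
    f z ∈ cyclicSpan f v := by
  induction hz using Submodule.span_induction with
  | mem x hx =>
    obtain ⟨k, rfl⟩ := hx
    rw [← Module.End.mul_apply, ← pow_succ']
    exact pow_apply_mem_cyclicSpan f v (k + 1)
  | zero => rw [map_zero]; exact Submodule.zero_mem _
  | add x y _ _ hx hy => rw [map_add]; exact Submodule.add_mem _ hx hy
  | smul a x _ hx => rw [map_smul]; exact Submodule.smul_mem _ a hx

/-- Elements of `K[f]·v` are `p(f) v`. [cite: Lang2002, Ch. XIV §2] -/
theorem exists_aeval_apply_eq_of_mem_cyclicSpan (f : Module.End K V) (v : V) {z : V}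
    (hz : z ∈ cyclicSpan f v) : ∃ p : K[X], aeval f p v = z := by
  induction hz using Submodule.span_induction with
  | mem x hx =>
    obtain ⟨k, rfl⟩ := hx
    exact ⟨X ^ k, by rw [aeval_X_pow]⟩
  | zero => exact ⟨0, by simp⟩
  | add x y _ _ hx hy =>
    obtain ⟨p, rfl⟩ := hx
    obtain ⟨q, rfl⟩ := hy
    exact ⟨p + q, by simp⟩
  | smul a x _ hx =>
    obtain ⟨p, rfl⟩ := hx
    exact ⟨a • p, by simp⟩

/-- `p(f) v ∈ K[f]·v`. [cite: Lang2002, Ch. XIV §2] -/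
theorem aeval_apply_mem_cyclicSpan (f : Module.End K V) (v : V) (p : K[X]) :
    aeval f p v ∈ cyclicSpan f v := by
  rw [aeval_eq_sum_range, LinearMap.sum_apply]
  refine Submodule.sum_mem _ fun k _ => ?_
  rw [LinearMap.smul_apply]
  exact Submodule.smul_mem _ _ (pow_apply_mem_cyclicSpan f v k)

/-- `K[f]·(f u) ⊆ range f`. [cite: Lang2002, Ch. XIV §2] -/
theorem cyclicSpan_le_range (f : Module.End K V) (u : V) :
    cyclicSpan f (f u) ≤ LinearMap.range f := by
  rw [cyclicSpan, Submodule.span_le]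
  rintro _ ⟨k, rfl⟩
  change (f ^ k) (f u) ∈ LinearMap.range f
  rw [← Module.End.mul_apply, ← pow_succ, pow_succ', Module.End.mul_apply]
  exact LinearMap.mem_range_self f _

/-- A polynomial in a `B`-self-adjoint endomorphism is `B`-self-adjoint.
[cite: Lang2002, Ch. XV §6–§7 (symmetric operators)] -/
theorem aeval_selfAdjoint (B : LinearMap.BilinForm K V) {f : Module.End K V}
    (hf : ∀ a b, B (f a) b = B a (f b)) (p : K[X]) (a b : V) :
    B (aeval f p a) b = B a (aeval f p b) := by
  have hpow : ∀ (k : ℕ) (a b : V), B ((f ^ k) a) b = B a ((f ^ k) b) := by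
    intro k
    induction k with
    | zero => intro a b; simp
    | succ k ih =>
      intro a b
      have hc : f ((f ^ k) b) = (f ^ k) (f b) := by
        rw [← Module.End.mul_apply, ← pow_succ', pow_succ, Module.End.mul_apply]
      rw [pow_succ, Module.End.mul_apply, Module.End.mul_apply, ih, hf, hc]
  rw [aeval_eq_sum_range, LinearMap.sum_apply, LinearMap.sum_apply, map_sum, LinearMap.sum_apply,
    map_sum]
  refine Finset.sum_congr rfl fun k _ => ?_
  rw [LinearMap.smul_apply, LinearMap.smul_apply, map_smul, LinearMap.smul_apply, map_smul, hpow]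

/-- On an eigenvector, `p(f)` acts by `p(e)` (also for the zero vector). [cite: Lang2002, Ch. XIV §3] -/
theorem aeval_apply_of_eigen {f : Module.End K V} {e : K} {x : V} (hx : f x = e • x) (p : K[X]) :
    aeval f p x = p.eval e • x := by
  by_cases h0 : x = 0
  · rw [h0, map_zero, smul_zero]
  · exact Module.End.aeval_apply_of_hasEigenvector ⟨Module.End.mem_eigenspace_iff.2 hx, h0⟩

end Cyclic

/-! ### §3 The rational symmetries `R_v` through `ℚ[θ]·v ⊂ Λ_ℚ` and their complexification -/

section K3

variable (θ : Matrix K3Index K3Index ℚ)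

/-- The cyclic subspace `Z_v = ℚ[θ]·v ⊂ Λ_ℚ` of the model endomorphism `θ`. [cite: GeemenSchutt2023, §2.1 (T_{X,ℚ} as an `F`-vector space)] -/
abbrev cycQ (v : K3Index → ℚ) : Submodule ℚ (K3Index → ℚ) := cyclicSpan (Matrix.toLin' θ) v

/-- The `ℂ`-submodule of `Λ_ℂ` of vectors `k3Form`-orthogonal to (the image of) a rational subspace `M`.
[cite: Huybrechts2016K3, Ch. 3 Lemma 3.1 (p. 62–63)] -/
def orthC (M : Submodule ℚ (K3Index → ℚ)) : Submodule ℂ (K3Index → ℂ) where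
  carrier := {y | ∀ z ∈ M, k3FormC (fun i => (z i : ℂ)) y = 0}
  add_mem' := by
    intro a b ha hb z hz
    rw [map_add, ha z hz, hb z hz, add_zero]
  zero_mem' := by
    intro z _
    rw [map_zero]
  smul_mem' := by
    intro c a ha z hz
    rw [map_smul, ha z hz, smul_zero]

/-- Membership in `orthC M`, in terms of `k3Form`. [cite: Huybrechts2016K3, Ch. 3 Lemma 3.1 (p. 62–63)] -/
theorem mem_orthC {M : Submodule ℚ (K3Index → ℚ)} {y : K3Index → ℂ} :
    y ∈ orthC M ↔ ∀ z ∈ M, k3Form (fun i => (z i : ℂ)) y = 0 := by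
  simp only [orthC, Submodule.mem_mk, AddSubmonoid.mem_mk, AddSubsemigroup.mem_mk, Set.mem_setOf_eq,
    k3FormC_apply]

variable {θ}

/-- `θ` self-adjoint for `k3Form` on `Λ_ℂ` is self-adjoint for `k3FormRat` on `Λ_ℚ`. [cite: GeemenSchutt2023, §2.1] -/
theorem selfAdjoint_rat (hθsa : ∀ a b : K3Index → ℂ, k3Form (thetaC θ a) b = k3Form a (thetaC θ b))
    (a b : K3Index → ℚ) : k3FormRat (Matrix.toLin' θ a) b = k3FormRat a (Matrix.toLin' θ b) := by
  apply Rat.cast_injective (α := ℂ)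
  rw [← k3Form_ratCast, ← k3Form_ratCast, Matrix.toLin'_apply, Matrix.toLin'_apply, ← thetaC_ratCast,
    ← thetaC_ratCast, hθsa]

/-- **The rational symmetry `R_v`** through `Z_v = ℚ[θ]·v` (defined when `k3FormRat` is non-degenerate
on `Z_v`): an isometry of `Λ_ℚ` commuting with `θ`. [cite: Omeara1963, §42] -/
def ratSymm (v : K3Index → ℚ) (hZ : (k3FormRat.restrict (cycQ θ v)).Nondegenerate) :
    Module.End ℚ (K3Index → ℚ) :=
  subspaceSymm k3FormRat (cycQ θ v) k3FormRat_isSymm.isRefl hZ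

/-- Its complexification `R_v ⊗ ℂ ∈ End(Λ_ℂ)` (a rational matrix acting on `Λ_ℂ`). [cite: Omeara1963, §42] -/
def ratSymmC (v : K3Index → ℚ) (hZ : (k3FormRat.restrict (cycQ θ v)).Nondegenerate) :
    Module.End ℂ (K3Index → ℂ) :=
  thetaC (LinearMap.toMatrix' (ratSymm v hZ))

variable {v : K3Index → ℚ} (hZ : (k3FormRat.restrict (cycQ θ v)).Nondegenerate)

/-- `R_v` is an isometry of `(Λ_ℚ, k3FormRat)`. [cite: Omeara1963, §42] -/
theorem ratSymm_isometry (a b : K3Index → ℚ) :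
    k3FormRat (ratSymm v hZ a) (ratSymm v hZ b) = k3FormRat a b :=
  isOrthogonal_subspaceSymm _ hZ a b

/-- `R_v` commutes with `θ` (which preserves `Z_v` and, being self-adjoint, `Z_v^⊥`). [cite: Omeara1963, §42] -/
theorem ratSymm_comm (hθsa : ∀ a b : K3Index → ℂ, k3Form (thetaC θ a) b = k3Form a (thetaC θ b)) :
    ratSymm v hZ ∘ₗ Matrix.toLin' θ = Matrix.toLin' θ ∘ₗ ratSymm v hZ :=
  subspaceSymm_comp_eq _ hZ (fun _ hz => map_mem_cyclicSpan _ v hz)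
    (fun _ hu => map_mem_orthogonal_of_selfAdjoint (selfAdjoint_rat hθsa)
      (fun _ hz => map_mem_cyclicSpan _ v hz) hu)

/-- `R_v = −1` on `Z_v`. [cite: Omeara1963, §42] -/
theorem ratSymm_apply_of_mem {z : K3Index → ℚ} (hz : z ∈ cycQ θ v) : ratSymm v hZ z = -z :=
  subspaceSymm_apply_of_mem _ hZ hz

/-- `R_v = +1` on `Z_v^⊥`. [cite: Omeara1963, §42] -/
theorem ratSymm_apply_of_mem_orthogonal {u : K3Index → ℚ} (hu : u ∈ k3FormRat.orthogonal (cycQ θ v)) :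
    ratSymm v hZ u = u :=
  subspaceSymm_apply_of_mem_orthogonal _ hZ hu

/-- A rational linear map, complexified as a matrix, acts on rational vectors as the map.
[cite: Huybrechts2016K3, Ch. 6 Rem. 3.3] -/
theorem thetaC_toMatrix'_ratCast (f : Module.End ℚ (K3Index → ℚ)) (u : K3Index → ℚ) :
    thetaC (LinearMap.toMatrix' f) (fun i => (u i : ℂ)) = fun i => (f u i : ℂ) := by
  rw [thetaC_ratCast, LinearMap.toMatrix'_mulVec]

/-- Complexification is multiplicative. [cite: Huybrechts2016K3, Ch. 6 Rem. 3.3] -/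
theorem thetaC_mul (A C : Matrix K3Index K3Index ℚ) : thetaC (A * C) = thetaC A ∘ₗ thetaC C := by
  unfold thetaC
  rw [← Matrix.toLin'_mul]
  congr 1
  exact Matrix.map_mul (f := (algebraMap ℚ ℂ : ℚ →+* ℂ))

/-- `R_v ⊗ ℂ` commutes with `θ_ℂ`. [cite: Omeara1963, §42] -/
theorem ratSymmC_comm (hθsa : ∀ a b : K3Index → ℂ, k3Form (thetaC θ a) b = k3Form a (thetaC θ b)) :
    ratSymmC v hZ ∘ₗ thetaC θ = thetaC θ ∘ₗ ratSymmC v hZ := by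
  have h := congrArg LinearMap.toMatrix' (ratSymm_comm hZ hθsa)
  rw [LinearMap.toMatrix'_comp, LinearMap.toMatrix'_comp, LinearMap.toMatrix'_toLin'] at h
  rw [ratSymmC, ← thetaC_mul, h, thetaC_mul]

/-- `R_v ⊗ ℂ` on rational vectors. [cite: Omeara1963, §42] -/
theorem ratSymmC_ratCast (u : K3Index → ℚ) :
    ratSymmC v hZ (fun i => (u i : ℂ)) = fun i => (ratSymm v hZ u i : ℂ) :=
  thetaC_toMatrix'_ratCast _ u

/-- `R_v ⊗ ℂ` maps lattice vectors to rational vectors. [cite: Buskin2019, §6.2] -/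
theorem ratSymmC_intCast (w : K3Index → ℤ) :
    ∃ u : K3Index → ℚ, ratSymmC v hZ (fun i => (w i : ℂ)) = fun i => (u i : ℂ) :=
  ⟨ratSymm v hZ (fun i => (w i : ℚ)), by rw [intCast_eq_ratCast_intCast, ratSymmC_ratCast]⟩

/-- `R_v ⊗ ℂ` is an isometry of `(Λ_ℂ, k3Form)`. [cite: Omeara1963, §42] -/
theorem ratSymmC_isometry (a b : K3Index → ℂ) :
    k3Form (ratSymmC v hZ a) (ratSymmC v hZ b) = k3Form a b := by
  have hcast : ∀ j : K3Index, (fun i => ((Pi.single j (1 : ℚ) : K3Index → ℚ) i : ℂ)) = Pi.single j 1 := by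
    intro j
    funext i
    by_cases hij : i = j
    · subst hij; simp
    · simp [Pi.single_eq_of_ne hij]
  have key : k3FormC.comp (ratSymmC v hZ) (ratSymmC v hZ) = k3FormC := by
    refine LinearMap.BilinForm.ext_basis (Pi.basisFun ℂ K3Index) fun i j => ?_
    rw [LinearMap.BilinForm.comp_apply, Pi.basisFun_apply, Pi.basisFun_apply, ← hcast i, ← hcast j,
      ratSymmC_ratCast, ratSymmC_ratCast, k3FormC_ratCast, k3FormC_ratCast, ratSymm_isometry]
  have h := congrArg (fun B : LinearMap.BilinForm ℂ (K3Index → ℂ) => B a b) key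
  simp only [LinearMap.BilinForm.comp_apply, k3FormC_apply] at h
  exact h

/-- `R_v ⊗ ℂ = −1` on the image of `Z_v`. [cite: Omeara1963, §42] -/
theorem ratSymmC_ratCast_of_mem {z : K3Index → ℚ} (hz : z ∈ cycQ θ v) :
    ratSymmC v hZ (fun i => (z i : ℂ)) = -fun i => (z i : ℂ) := by
  rw [ratSymmC_ratCast, ratSymm_apply_of_mem hZ hz]
  funext i
  simp

/-- `R_v ⊗ ℂ = +1` on the image of `Z_v^⊥`. [cite: Omeara1963, §42] -/
theorem ratSymmC_ratCast_of_mem_orthogonal {u : K3Index → ℚ} (hu : u ∈ k3FormRat.orthogonal (cycQ θ v)) :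
    ratSymmC v hZ (fun i => (u i : ℂ)) = fun i => (u i : ℂ) := by
  rw [ratSymmC_ratCast, ratSymm_apply_of_mem_orthogonal hZ hu]

/-- **`R_v ⊗ ℂ = +1` on the complexified orthogonal `(Z_v ⊗ ℂ)^⊥`** — base change of the orthogonal
decomposition `Λ_ℚ = Z_v ⊕ Z_v^⊥` (`eq_span_ratCast_of_forall_mem_iff`).
[cite: Huybrechts2016K3, Ch. 3 Lemma 3.1 (p. 62–63)] -/
theorem ratSymmC_apply_of_mem_orthC {y : K3Index → ℂ} (hy : y ∈ orthC (cycQ θ v)) :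
    ratSymmC v hZ y = y := by
  classical
  set O := k3FormRat.orthogonal (cycQ θ v) with hO
  let b := Module.finBasis ℚ O
  have hli : LinearIndependent ℚ (fun k => (b k : K3Index → ℚ)) :=
    b.linearIndependent.map' O.subtype (Submodule.ker_subtype O)
  have hsp : Submodule.span ℚ (Set.range fun k => (b k : K3Index → ℚ)) = O := by
    have h1 : Set.range (fun k => (b k : K3Index → ℚ)) = O.subtype '' Set.range b := by
      rw [← Set.range_comp]; rfl
    rw [h1, ← Submodule.map_span, b.span_eq, Submodule.map_top, Submodule.range_subtype]
  have hc : IsCompl (cycQ θ v) O :=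
    LinearMap.BilinForm.isCompl_orthogonal_of_restrict_nondegenerate k3FormRat_isSymm.isRefl hZ
  have hTK : ∀ z : K3Index → ℂ, z ∈ orthC (cycQ θ v) ↔
      ∀ w ∈ cycQ θ v, k3FormC (fun i => (w i : ℂ)) z = 0 := fun z => Iff.rfl
  have heq := eq_span_ratCast_of_forall_mem_iff ℂ k3FormC k3FormC_ratCast hZ hc hli hsp hTK
  rw [heq] at hy
  have hle : Submodule.span ℂ (Set.range fun k i => ((b k : K3Index → ℚ) i : ℂ)) ≤
      LinearMap.eqLocus (ratSymmC v hZ) LinearMap.id := by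
    rw [Submodule.span_le]
    rintro _ ⟨k, rfl⟩
    rw [SetLike.mem_coe, LinearMap.mem_eqLocus, LinearMap.id_apply]
    exact ratSymmC_ratCast_of_mem_orthogonal hZ (b k).2
  have h := hle hy
  rwa [LinearMap.mem_eqLocus, LinearMap.id_apply] at h

end K3

end Summit.HodgeConjecture.HodgeConjecture.Theorems.MarkmanPartnerTransport.RMTypeOrbit

end
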